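import Literature.ComputerArithmetic.Rump2006.CholeskyPositiveDefinite

/-!
# Floating-point Cholesky whose division step is a multiplication by a rounded reciprocal:
# Rump's criteria hold verbatim with the unit roundoff `2u + u²`

HONEST FRAMING (cell certnum, L1 interval linear algebra; seat certnum-ila-3, author of the engine
module `cap.ila.psd` and of its «certified-fp» sub-mode `fpapriori`): this cell ships TOOLS and
SOUNDNESS STATEMENTS; every certified number belongs to a client cell's ledger. This module closes a
gap between the HYPOTHESIS of `Literature.ComputerArithmetic.Rump2006.CholeskyPositiveDefinite` and
the Cholesky decompositions that numerical libraries actually execute. No named facts, no `sorry`.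

THE GAP. `CholeskyRun u A R̃` (the formalisation of [Rump2006] (2.1)/(2.6) and of Roux's
`cholesky_spec`) asks that every off-diagonal entry be ONE rounding away from the exact quotient:
`|r̃_{ij} - s̃ / r̃_{ii}| ≤ u |s̃ / r̃_{ii}|`. Library Cholesky routines do not divide: the column below
a computed pivot is SCALED by the rounded reciprocal `w = fl(1 / r̃_{ii})` (reference LAPACK `DPOTF2`
calls `DSCAL(N-J, ONE/AJJ, …)`; the recursive `DPOTRF2` hands the panel to `DTRSM`, whose right-side
branches hoist `TEMP = ONE/A(K,K)` out of the loop; OpenBLAS' `potf2` and its `trsm` kernels pack the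
inverted diagonal `INV(a) = ONE/a`), so `r̃_{ij} = fl(s̃ · w)` carries TWO rounding factors. Such a
run is in general NOT a `CholeskyRun u`, and a certificate that instantiates Rump's Corollary 2.4 with
`u = 2⁻⁵³` for such a run claims a hypothesis it has not got.

THE REPAIR PROVED HERE (elementary; the analysis itself is untouched):
* `STree.WF.mono`, `CTree.WF.mono`, `CholeskyRun.mono` — the standard model is monotone in `u`;
* `abs_sub_div_le_of_recip` — `|w - b⁻¹| ≤ u|b⁻¹|` and `|y - s·w| ≤ u|s·w|` give
  `|y - s/b| ≤ (2u + u²)|s/b|` (two rounding factors `(1+δ₁)(1+δ₂)`, [Higham2002ASNA] Lemma 3.1);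
* `CholeskyRunRecip u A R̃` — the run with the reciprocal step (it CONTAINS the textbook run:
  `CholeskyRun.toRecip`, exact reciprocal `w = r̃_{ii}⁻¹`);
* `CholeskyRunRecip.toCholeskyRun` — such a run IS a `CholeskyRun (2u + u²) A R̃`;
* hence every theorem of the parent file applies with `u' := 2u + u²` in place of `u`; the three
  criteria the engine cites are restated in that dress: `quadForm_pos_of_shifted_cholesky_apriori_recip`
  ([Rump2006] Corollary 2.4 with the a-priori constant, [Rump2010Verification] §10.8.1),
  `posDef_of_shifted_cholesky_recip` (`K = ℝ`, Mathlib `Matrix.PosDef`) and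
  `quadForm_pos_of_shifted_cholesky_interval'_recip` ([Rump2010Verification] Lemma 10.14 with (10.61)).
For binary64, `u' = 2⁻⁵² + 2⁻¹⁰⁶`: the shift constant `c = Σ_j φ_{j+2}(u') ã_{jj}` is (to first
order) twice the textbook one — the price of not auditing a BLAS binary. (The parent file's entrywise
bound `γ_{min(i,j)+2}` has one spare rounding off the diagonal, so the SAME constants survive the
reciprocal step; that sharper statement is not proved here.)

WHAT IS NOT HERE / NOT CLAIMED: nothing about any particular library binary (that a given `dpotrf`
has the substitution-with-scaling shape is the certificate's audited hypothesis, not a theorem);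
triangular solves realised by INVERTING diagonal BLOCKS (`TRTRI` + `GEMM`, common on GPUs) are NOT
of this shape and are not covered; Strassen-type products, double rounding through extended formats
and the underflow terms (`eta`) remain excluded exactly as in the parent file.
-/

namespace Literature.ComputerArithmetic.Rump2006

open Finset Matrix
open Literature.ComputerArithmetic.Higham2002

variable {K : Type*} [Field K] [LinearOrder K] [IsStrictOrderedRing K]

/-! ### The standard model is monotone in the unit roundoff -/

section Mono

variable {u u' : K}

omit [IsStrictOrderedRing K] in
/-- a single standard-model inequality survives enlarging `u`. [cite: Higham2002ASNA, (2.4)] -/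
theorem round_mono [IsOrderedRing K] (huu : u ≤ u') {v t : K} (h : |v - t| ≤ u * |t|) :
    |v - t| ≤ u' * |t| :=
  h.trans (mul_le_mul_of_nonneg_right huu (abs_nonneg t))

/-- well-formed sum trees stay well formed for a larger unit roundoff. [cite: Higham2002ASNA, (2.4)] -/
theorem STree.WF.mono (huu : u ≤ u') : ∀ t : STree K, t.WF u → t.WF u'
  | .leaf z zh, h => by
      simp only [STree.WF] at h ⊢
      exact round_mono huu h
  | .add v l r, h => by
      simp only [STree.WF] at h ⊢
      exact ⟨STree.WF.mono huu l h.1, STree.WF.mono huu r h.2.1, round_mono huu h.2.2⟩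
  | .fma v l z, h => by
      simp only [STree.WF] at h ⊢
      exact ⟨STree.WF.mono huu l h.1, round_mono huu h.2⟩

/-- well-formed `c - Σ z_ℓ` evaluations stay well formed for a larger unit roundoff.
[cite: Higham2002ASNA, (2.4)] -/
theorem CTree.WF.mono (huu : u ≤ u') : ∀ e : CTree K, e.WF u → e.WF u'
  | .start c, _ => by simp only [CTree.WF]
  | .sub v e t, h => by
      simp only [CTree.WF] at h ⊢
      exact ⟨CTree.WF.mono huu e h.1, STree.WF.mono huu t h.2.1, round_mono huu h.2.2⟩
  | .fsub v e z, h => by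
      simp only [CTree.WF] at h ⊢
      exact ⟨CTree.WF.mono huu e h.1, round_mono huu h.2⟩

variable {n : ℕ} {A R : Matrix (Fin n) (Fin n) K}

/-- a floating-point Cholesky run for the unit roundoff `u` is one for every `u' ≥ u`.
[cite: Rump2006, (2.1) and (2.6)] [cite: Higham2002ASNA, (2.4)] -/
theorem CholeskyRun.mono (huu : u ≤ u') (h : CholeskyRun u A R) : CholeskyRun u' A R where
  lower := h.lower
  offDiag i j hij := by
    obtain ⟨e, he, hc, hp, hii, hy⟩ := h.offDiag i j hij
    exact ⟨e, CTree.WF.mono huu e he, hc, hp, hii, round_mono huu hy⟩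
  diag j := by
    obtain ⟨e, he, hc, hp, δ, hδ, hy⟩ := h.diag j
    exact ⟨e, CTree.WF.mono huu e he, hc, hp, δ, hδ.trans huu, hy⟩

end Mono

/-! ### Two roundings: `y = fl(s · fl(1/b))` -/

/-- If `w` is one rounding away from `b⁻¹` and `y` one rounding away from `s · w`, then `y` is within
the relative distance `2u + u²` of the exact quotient `s / b` (the product of two rounding factors
`(1 + δ₁)(1 + δ₂)`, `|δ_ν| ≤ u`). [cite: Higham2002ASNA, Lemma 3.1] -/
theorem abs_sub_div_le_of_recip {u s b w y : K} (hu : 0 ≤ u)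
    (hw : |w - b⁻¹| ≤ u * |b⁻¹|) (hy : |y - s * w| ≤ u * |s * w|) :
    |y - s / b| ≤ (2 * u + u * u) * |s / b| := by
  have h1 : |s * w - s / b| ≤ u * |s / b| := by
    rw [div_eq_mul_inv, ← mul_sub, abs_mul, abs_mul]
    calc |s| * |w - b⁻¹| ≤ |s| * (u * |b⁻¹|) := mul_le_mul_of_nonneg_left hw (abs_nonneg s)
      _ = u * (|s| * |b⁻¹|) := by ring
  have h2 : |s * w| ≤ (1 + u) * |s / b| := by
    have := abs_sub_abs_le_abs_sub (s * w) (s / b)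
    linarith
  calc |y - s / b| = |(y - s * w) + (s * w - s / b)| := by ring_nf
    _ ≤ |y - s * w| + |s * w - s / b| := abs_add_le _ _
    _ ≤ u * |s * w| + u * |s / b| := add_le_add hy h1
    _ ≤ u * ((1 + u) * |s / b|) + u * |s / b| :=
        add_le_add (mul_le_mul_of_nonneg_left h2 hu) le_rfl
    _ = (2 * u + u * u) * |s / b| := by ring

/-! ### The run with reciprocal scaling -/

section Recip

variable {u : K} {n : ℕ}

/-- "The floating-point Cholesky decomposition of the symmetric `A`, executed IN ANY ORDER, RUNS TO
COMPLETION with computed factor `R̃`" — exactly as `CholeskyRun u A R̃` ([Rump2006] (2.1)/(2.6),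
Roux's `cholesky_spec`) except for the off-diagonal step, which is the LIBRARY form: the entry is
obtained from the computed numerator `s̃` (any well-formed evaluation of `a_{ij} - Σ_{k<i} r̃_{ki} r̃_{kj}`)
by a multiplication with a ROUNDED RECIPROCAL of the pivot, `w = fl(1/r̃_{ii})`, `r̃_{ij} = fl(s̃ · w)`
— two standard-model roundings instead of the single division of the textbook scheme (reference
LAPACK `DPOTF2`/`DTRSM`, OpenBLAS `potf2`/`trsm` kernels scale by a stored reciprocal).
[cite: Rump2006, (2.1) and (2.6)] [cite: Higham2002ASNA, Algorithm 10.2] -/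
structure CholeskyRunRecip (u : K) (A R : Matrix (Fin n) (Fin n) K) : Prop where
  lower : ∀ i j : Fin n, j < i → R i j = 0
  offDiag : ∀ i j : Fin n, i < j → ∃ e : CTree K, e.WF u ∧ e.const = A i j ∧
    e.terms.Perm (prods R i j) ∧ R i i ≠ 0 ∧
    ∃ w : K, |w - (R i i)⁻¹| ≤ u * |(R i i)⁻¹| ∧ |R i j - e.val * w| ≤ u * |e.val * w|
  diag : ∀ j : Fin n, ∃ e : CTree K, e.WF u ∧ e.const = A j j ∧ e.terms.Perm (prods R j j) ∧
    ∃ δ : K, |δ| ≤ u ∧ R j j ^ 2 = e.val * (1 + δ) ^ 2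

variable {A R : Matrix (Fin n) (Fin n) K}

/-- The textbook run (one true division) is a reciprocal run with the EXACT reciprocal
`w = r̃_{ii}⁻¹`: `CholeskyRunRecip` generalises `CholeskyRun`. [cite: Rump2006, (2.1) and (2.6)] -/
theorem CholeskyRun.toRecip (hu : 0 ≤ u) (h : CholeskyRun u A R) : CholeskyRunRecip u A R where
  lower := h.lower
  offDiag i j hij := by
    obtain ⟨e, he, hc, hp, hii, hy⟩ := h.offDiag i j hij
    refine ⟨e, he, hc, hp, hii, (R i i)⁻¹, ?_, ?_⟩
    · rw [sub_self, abs_zero]; exact mul_nonneg hu (abs_nonneg _)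
    · rw [← div_eq_mul_inv]; exact hy
  diag := h.diag

/-- THE REDUCTION: a Cholesky run whose off-diagonal step multiplies by a rounded reciprocal is a
textbook run (`CholeskyRun`) for the unit roundoff `2u + u²` — so every result of
`CholeskyPositiveDefinite` ([Rump2006] Theorem 2.3, Corollaries 2.4/2.7, [Rump2010Verification]
Lemmas 10.13/10.14) applies to it with `u' = 2u + u²` in place of `u`.
[cite: Rump2006, Theorem 2.3] [cite: Higham2002ASNA, Lemma 3.1] -/
theorem CholeskyRunRecip.toCholeskyRun (hu : 0 ≤ u) (h : CholeskyRunRecip u A R) :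
    CholeskyRun (2 * u + u * u) A R where
  lower := h.lower
  offDiag i j hij := by
    have huu : u ≤ 2 * u + u * u := by nlinarith [mul_nonneg hu hu]
    obtain ⟨e, he, hc, hp, hii, w, hw, hy⟩ := h.offDiag i j hij
    exact ⟨e, CTree.WF.mono huu e he, hc, hp, hii, abs_sub_div_le_of_recip hu hw hy⟩
  diag j := by
    have huu : u ≤ 2 * u + u * u := by nlinarith [mul_nonneg hu hu]
    obtain ⟨e, he, hc, hp, δ, hδ, hy⟩ := h.diag j
    exact ⟨e, CTree.WF.mono huu e he, hc, hp, δ, hδ.trans huu, hy⟩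

/-- RUMP 2006 COROLLARY 2.4 with the A-PRIORI constant ([Rump2010Verification] §10.8.1, `isspd`) for
a run WITH RECIPROCAL SCALING: with `u' = 2u + u²`, if `2(n+1)u' < 1`, `0 ≤ c`,
`Σ_j φ_{j+2}(u') a_{jj} ≤ c`, `Ã` agrees with `A` off the diagonal, `ã_{jj} ≤ a_{jj} - c`, and the
Cholesky of `Ã` runs to completion with positive computed pivots, then `xᵀ A x > 0` for `x ≠ 0`.
[cite: Rump2006, Corollary 2.4] [cite: Rump2010Verification, Section 10.8.1] -/
theorem quadForm_pos_of_shifted_cholesky_apriori_recip (hu : 0 ≤ u)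
    (h2n : 2 * ((n : K) + 1) * (2 * u + u * u) < 1) {A At R : Matrix (Fin n) (Fin n) K}
    (hAt : Atᵀ = At) (hrun : CholeskyRunRecip u At R) (hpos : ∀ j, 0 < R j j) {c : K}
    (hc0 : 0 ≤ c) (hoff : ∀ i j, i ≠ j → At i j = A i j) (hdiag : ∀ i, At i i ≤ A i i - c)
    (hc : ∑ j : Fin n, gamma (2 * u + u * u) (j.val + 2) / (1 - gamma (2 * u + u * u) (j.val + 2))
      * A j j ≤ c)
    (x : Fin n → K) (hx : x ≠ 0) : 0 < x ⬝ᵥ (A *ᵥ x) :=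
  quadForm_pos_of_shifted_cholesky_apriori (by nlinarith [mul_nonneg hu hu]) h2n hAt
    (hrun.toCholeskyRun hu) hpos hc0 hoff hdiag hc x hx

/-- RUMP 2010 LEMMA 10.14 with (10.61) (interval input, root-free Collatz bound) for a run WITH
RECIPROCAL SCALING: the parent file's `quadForm_pos_of_shifted_cholesky_interval'` with `u' = 2u + u²`.
[cite: Rump2010Verification, Lemma 10.14 and (10.61)] [cite: Rump2006, Corollary 2.7] -/
theorem quadForm_pos_of_shifted_cholesky_interval'_recip (hu : 0 ≤ u)
    (h2n : 2 * ((n : K) + 1) * (2 * u + u * u) < 1) {A At R Rad : Matrix (Fin n) (Fin n) K}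
    (hAt : Atᵀ = At) (hrun : CholeskyRunRecip u At R) (hpos : ∀ j, 0 < R j j)
    (hRad0 : ∀ i j, 0 ≤ Rad i j) {v : Fin n → K} (hv : ∀ i, 0 < v i) {μ r c : K}
    (hμ : ∀ i, (Radᵀ *ᵥ (Rad *ᵥ v)) i ≤ μ * v i) (hμr : μ ≤ r ^ 2) (hr0 : 0 ≤ r)
    (hoff : ∀ i j, i ≠ j → At i j = A i j) (hdiag : ∀ i, At i i ≤ A i i - c - r)
    (hc : ∑ j : Fin n, gamma (2 * u + u * u) (j.val + 2) / (1 - gamma (2 * u + u * u) (j.val + 2))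
      * At j j ≤ c)
    (X : Matrix (Fin n) (Fin n) K) (hX : ∀ i j, |X i j - A i j| ≤ Rad i j)
    (y : Fin n → K) (hy : y ≠ 0) : 0 < y ⬝ᵥ (X *ᵥ y) :=
  quadForm_pos_of_shifted_cholesky_interval' (by nlinarith [mul_nonneg hu hu]) h2n hAt
    (hrun.toCholeskyRun hu) hpos hRad0 hv hμ hμr hr0 hoff hdiag hc X hX y hy

end Recip

/-- RUMP 2006 COROLLARY 2.4 / RUMP 2010 §10.8.1 over `ℝ`, packaged as Mathlib's `Matrix.PosDef`, for a
run WITH RECIPROCAL SCALING (`u' = 2u + u²`; for binary64, `u = 2⁻⁵³` and `u' = 2⁻⁵² + 2⁻¹⁰⁶`): the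
statement the engine's «certified-fp» certificate instantiates when the factorisation was produced by
a library `potrf`. [cite: Rump2006, Corollary 2.4] [cite: Rump2010Verification, Section 10.8.1] -/
theorem posDef_of_shifted_cholesky_recip {n : ℕ} {u : ℝ} (hu : 0 ≤ u)
    (h2n : 2 * ((n : ℝ) + 1) * (2 * u + u * u) < 1) {A At R : Matrix (Fin n) (Fin n) ℝ}
    (hAt : Atᵀ = At) (hrun : CholeskyRunRecip u At R) (hpos : ∀ j, 0 < R j j) {c : ℝ}
    (hoff : ∀ i j, i ≠ j → At i j = A i j) (hdiag : ∀ i, At i i ≤ A i i - c)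
    (hc : ∑ j : Fin n, gamma (2 * u + u * u) (j.val + 2) / (1 - gamma (2 * u + u * u) (j.val + 2))
      * At j j ≤ c) :
    A.PosDef :=
  posDef_of_shifted_cholesky (by nlinarith [mul_nonneg hu hu]) h2n hAt (hrun.toCholeskyRun hu) hpos
    hoff hdiag hc

/-- Sanity (non-vacuity of `CholeskyRunRecip`, and the reciprocal step in action): the exact `2 × 2`
decomposition `!![4, 2; 2, 2] = R̃ᵀ R̃`, `R̃ = !![2, 1; 0, 1]`, with the off-diagonal entry computed as
`r̃₀₁ = s̃ · w = 2 · (1/2)`, is a reciprocal run with unit roundoff `u = 0`. -/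
example : CholeskyRunRecip (0 : ℚ) !![(4 : ℚ), 2; 2, 2] !![(2 : ℚ), 1; 0, 1] where
  lower i j h := by
    fin_cases i <;> fin_cases j <;> simp_all
  offDiag i j h := by
    fin_cases i <;> fin_cases j <;> simp at h
    refine ⟨CTree.start 2, trivial, by simp [CTree.const], by simp [CTree.terms, prods], by simp,
      (2 : ℚ)⁻¹, by simp, ?_⟩
    simp [CTree.val]
  diag j := by
    fin_cases j
    · refine ⟨CTree.start 4, trivial, by simp [CTree.const], by simp [CTree.terms, prods], 0,
        by simp, ?_⟩
      simp [CTree.val]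
      norm_num
    · refine ⟨CTree.fsub 1 (CTree.start 2) 1, ?_, by simp [CTree.const], ?_, 0, by simp, ?_⟩
      · norm_num [CTree.WF, CTree.val]
      · simp [CTree.terms, prods]
      · norm_num [CTree.val]

end Literature.ComputerArithmetic.Rump2006
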